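import Summits.KontsevichZagierPeriods.KontsevichZagierPeriods.Theses.LevelPairing
import Summits.KontsevichZagierPeriods.KontsevichZagierPeriods.Theses.ScissorsTransport
import Summits.KontsevichZagierPeriods.KontsevichZagierPeriods.Theses.ScissorsAvatars
import Summits.KontsevichZagierPeriods.KontsevichZagierPeriods.Theses.DimensionBudget
import Literature.NumberTheory.Transcendental.KZRelationsLE

/-! # Candidate pieces (defs only) for the BC2-redirect probes of `LevelPairing.SameDimRules12` (stmt-4695). -/

namespace Summit.KontsevichZagierPeriods.KontsevichZagierPeriods.Cruxes.SameDimRules12.Pieces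

open Literature.NumberTheory.Transcendental

/-- T₁ (D2): stable same-dimension rules 1–2 (rules 1a,1b,2 + free padding). -/
def StableSameDim : Prop :=
  ∀ ⦃n : ℕ⦄ (r r' : KZ.IntegralRep n), r.IsRational → r'.IsRational → r.value = r'.value →
    KZ.of r - KZ.of r' ∈ AddSubgroup.closure (KZ.domainAddRel ∪ KZ.integrandAddRel ∪ KZ.changeOfVariablesRel ∪
      {c | ∃ (n : ℕ) (r : KZ.IntegralRep n) (j : ℕ), c = KZ.of (r.slab j) - KZ.of r})

/-- Structural: padding is functorial on rules 1–2. -/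
def SlabCompatRules12 : Prop :=
  ∀ c ∈ KZ.domainAddRel ∪ KZ.integrandAddRel ∪ KZ.changeOfVariablesRel,
    FreeAbelianGroup.map (fun p : (Σ n, KZ.IntegralRep n) => (⟨p.1 + 1, p.2.slab 0⟩ : Σ n, KZ.IntegralRep n)) c ∈
      AddSubgroup.closure (KZ.domainAddRel ∪ KZ.integrandAddRel ∪ KZ.changeOfVariablesRel)

/-- T₂ (D4'): same-dimension Conjecture 1 within one extra dimension. -/
def SameDimWithinOne : Prop :=
  ∀ ⦃n : ℕ⦄ (r r' : KZ.IntegralRep n), r.IsRational → r'.IsRational → r.value = r'.value →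
    KZ.EquivalentLE (n + 1) r r'

/-- Structural: descent from height n+1 into KZ₁₂(n). -/
def HeightDescent : Prop :=
  ∀ ⦃n : ℕ⦄ (r r' : KZ.IntegralRep n), KZ.EquivalentLE (n + 1) r r' →
    KZ.of r - KZ.of r' ∈ AddSubgroup.closure (KZ.domainAddRel ∪ KZ.integrandAddRel ∪ KZ.changeOfVariablesRel)

/-- Structural D: same-dimension descent (difference form of ScissorsAvatars.DestabilisedScissors). -/
def SameDimDescent : Prop :=
  ∀ ⦃n : ℕ⦄ (r r' : KZ.IntegralRep n), KZ.Equivalent r r' →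
    KZ.of r - KZ.of r' ∈ AddSubgroup.closure (KZ.domainAddRel ∪ KZ.integrandAddRel ∪ KZ.changeOfVariablesRel)

/-- The summit restricted to equal dimensions. -/
def SummitSameDim : Prop :=
  ∀ ⦃n : ℕ⦄ (r r' : KZ.IntegralRep n), r.IsRational → r'.IsRational → r.value = r'.value → KZ.Equivalent r r'

/-- T₃ (D5): zero on the cube. -/
def ZeroOnCube : Prop :=
  ∀ ⦃n : ℕ⦄ (r : KZ.IntegralRep n), r.domain = {z | ∀ i, z i ∈ Set.Ioo (0 : ℝ) 1} → r.value = 0 →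
    KZ.of r ∈ AddSubgroup.closure (KZ.domainAddRel ∪ KZ.integrandAddRel ∪ KZ.changeOfVariablesRel)

/-- Structural for D5: cube normal form. -/
def CubeNormalForm : Prop :=
  ∀ ⦃n : ℕ⦄ (r : KZ.IntegralRep n), ∃ s : KZ.IntegralRep n, s.domain = {z | ∀ i, z i ∈ Set.Ioo (0 : ℝ) 1} ∧
    KZ.of r - KZ.of s ∈ AddSubgroup.closure (KZ.domainAddRel ∪ KZ.integrandAddRel ∪ KZ.changeOfVariablesRel)


/-!
## Evidence for (c)-in-content (AtLeastSummit)

Every candidate TRANSCENDENTAL piece implies the summit (by padding), though none does so by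
`exact? | simpa | aesop`: `SummitSameDim → KontsevichZagierPeriods` (= the proof of `LevelPairing.closes`);
`StableSameDim → KontsevichZagierPeriods` (slabs are Newton–Leibniz moves); `KontsevichZagierPeriods → NLE → StableSameDim`;
`SameDimWithinOne → KontsevichZagierPeriods`; `DimensionBudget.OneExtraDimension → KontsevichZagierPeriods`.
-/


open Literature.NumberTheory.Transcendental
open Summit.KontsevichZagierPeriods.KontsevichZagierPeriods.Theses

/-- Slabs keep KZ's literal rational shape. -/
theorem isRational_slab {k : ℕ} (s : KZ.IntegralRep k) (hs : s.IsRational) (j : ℕ) : (s.slab j).IsRational := by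
  obtain ⟨p, q, hq, heq⟩ := hs
  refine ⟨MvPolynomial.rename Fin.castSucc p, MvPolynomial.rename Fin.castSucc q, ?_, ?_⟩
  · intro z hz
    rw [MvPolynomial.aeval_rename]
    exact hq (Fin.init z) hz.1
  · intro z hz
    simp only [KZ.IntegralRep.integrand_slab, MvPolynomial.aeval_rename]
    exact heq hz.1

/-- Padding a rational representation to any higher dimension, inside `KZ.Equivalent`. -/
theorem exists_rational_equivalent_of_le {k : ℕ} (s : KZ.IntegralRep k) (hs : s.IsRational) {N : ℕ} (h : k ≤ N) :
    ∃ S : KZ.IntegralRep N, S.IsRational ∧ KZ.Equivalent s S := by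
  obtain ⟨d, rfl⟩ := Nat.exists_eq_add_of_le h
  induction d with
  | zero => exact ⟨s, hs, KZ.Equivalent.refl s⟩
  | succ d ih =>
    obtain ⟨S, hS, hsS⟩ := ih (Nat.le_add_right k d)
    exact ⟨S.slab 0, isRational_slab S hS 0, hsS.trans (S.equivalent_slab 0)⟩

/-- PADDING: the same-dimension summit implies the summit (so it is ≡ the summit; converse is specialisation). -/
theorem summit_of_summitSameDim (h : SummitSameDim) : KontsevichZagierPeriods := by
  intro n m r r' hr hr' hv
  obtain ⟨R, hR, hrR⟩ := exists_rational_equivalent_of_le r hr (Nat.le_add_right n m)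
  obtain ⟨R', hR', hrR'⟩ := exists_rational_equivalent_of_le r' hr' (Nat.le_add_left m n)
  have hval : R.value = R'.value := by
    rw [← KZ.Equivalent.value_eq_holds hrR, ← KZ.Equivalent.value_eq_holds hrR']
    exact hv
  exact hrR.trans ((h R R' hR hR' hval).trans hrR'.symm)

theorem summitSameDim_of_summit (h : KontsevichZagierPeriods) : SummitSameDim :=
  fun _ r r' hr hr' hv => h r r' hr hr' hv

/-- rules 1–2 ∪ slabs generate a subgroup of `relations` (each slab is one Newton–Leibniz move). -/
theorem closure_rules12_slab_le_relations :
    AddSubgroup.closure (KZ.domainAddRel ∪ KZ.integrandAddRel ∪ KZ.changeOfVariablesRel ∪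
      {c | ∃ (n : ℕ) (r : KZ.IntegralRep n) (j : ℕ), c = KZ.of (r.slab j) - KZ.of r}) ≤ KZ.relations := by
  refine (AddSubgroup.closure_le _).mpr ?_
  rintro c (((hc | hc) | hc) | ⟨n, r, j, rfl⟩)
  · exact KZ.domainAddRel_subset_relations hc
  · exact KZ.integrandAddRel_subset_relations hc
  · exact KZ.changeOfVariablesRel_subset_relations hc
  · exact KZ.newtonLeibnizRel_subset_relations (r.of_slab_sub_of_mem_newtonLeibnizRel j)

/-- T₁ = StableSameDim is AT LEAST the summit. -/
theorem summit_of_stableSameDim (h : StableSameDim) : KontsevichZagierPeriods :=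
  summit_of_summitSameDim fun _ r r' hr hr' hv => closure_rules12_slab_le_relations (h r r' hr hr' hv)

/-- … and is implied by summit ∧ NewtonLeibnizElimination (ScissorsTransport, stmt-2668): T₁ ≡ summit ∧ (NLE-content). -/
theorem stableSameDim_of_summit_NLE (hS : KontsevichZagierPeriods) (hN : ScissorsTransport.NewtonLeibnizElimination) :
    StableSameDim := by
  intro n r r' hr hr' hv
  have hle : KZ.relations ≤ AddSubgroup.closure (KZ.domainAddRel ∪ KZ.integrandAddRel ∪ KZ.changeOfVariablesRel ∪
      {c | ∃ (n : ℕ) (r : KZ.IntegralRep n) (j : ℕ), c = KZ.of (r.slab j) - KZ.of r}) := by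
    refine (AddSubgroup.closure_le _).mpr ?_
    rintro c (hc | hc)
    · exact AddSubgroup.subset_closure (Or.inl hc)
    · exact hN c hc
  exact hle (hS r r' hr hr' hv)

/-- T₂ = SameDimWithinOne is AT LEAST the summit. -/
theorem summit_of_sameDimWithinOne (h : SameDimWithinOne) : KontsevichZagierPeriods :=
  summit_of_summitSameDim fun n r r' hr hr' hv => KZ.relationsLE_le_relations (n + 1) (h r r' hr hr' hv)

/-- DimensionBudget.OneExtraDimension (stmt-14384) is AT LEAST the summit (pad dimension ≤ 1 pairs to dimension 2). -/
theorem summit_of_oneExtraDimension (h : DimensionBudget.OneExtraDimension) : KontsevichZagierPeriods := by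
  refine summit_of_summitSameDim fun n r r' hr hr' hv => ?_
  rcases Nat.lt_or_ge n 2 with hn | hn
  · obtain ⟨R, hR, hrR⟩ := exists_rational_equivalent_of_le r hr hn.le
    obtain ⟨R', hR', hrR'⟩ := exists_rational_equivalent_of_le r' hr' hn.le
    have hval : R.value = R'.value := by
      rw [← KZ.Equivalent.value_eq_holds hrR, ← KZ.Equivalent.value_eq_holds hrR']
      exact hv
    have h2 : KZ.Equivalent R R' :=
      KZ.relationsLE_le_relations _ (h (n := 2) (m := 2) (by norm_num) R R' hR hR' hval)
    exact hrR.trans (h2.trans hrR'.symm)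
  · exact KZ.relationsLE_le_relations _ (h (by rw [max_self]; exact hn) r r' hr hr' hv)


end Summit.KontsevichZagierPeriods.KontsevichZagierPeriods.Cruxes.SameDimRules12.Pieces
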